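import Summits.CriticalPhenomena.PercolationContinuityZ3.Theorems.PercNearOneGluingNoHeavyLowerTailSahiClassTTwoLevel
import Summits.CriticalPhenomena.PercolationContinuityZ3.Theorems.PercNearOneGluingNoHeavyLowerTailSahiClassTCoreStep
import Summits.CriticalPhenomena.PercolationContinuityZ3.Theorems.PercNearOneGluingNoHeavyLowerTailSahiTwoLevelIndependentTopsPair
import Mathlib.Tactic.Linarith
import Mathlib.Tactic.Ring
import HarnessLib

/-!
# `NoHeavyLowerTail` (crux stmt-CriticalPhenomena-4575), P2 — **THE OPEN CORE IN bnk-2's VOCABULARY**: Kahn's Conjecture 5 follows from `SahiTwoLevelPlus` at ONE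
# essential coordinate of every CORE triple; the residual core after ALL one-coordinate criteria in the tree

Support file (seat `prim-masterthm-p2`, gen 14; `--supports stmt-CriticalPhenomena-4575`).  No definition, no `sorry`, standard axioms.
Engine: `SahiClassTCube.sahiE_three_nonneg_of_core_step` (`…SahiClassTCoreStep`: the core step receives `C_3` for all triples of smaller total essential support).
Dictionary: `mixC1 = T + E_3(U⁰)`, `mixC2 = T⁺ + E_3(U¹)` (`…SahiClassTTwoLevel`).

* `mixC_nonneg_of_twoLevelPlus` — TOP law `T⁺ ≥ 0` at the section pair of `e` + `C_3` of both section triples ⟹ both mixed Bernstein coefficients at `e` are `≥ 0`.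
* **`masterFamilyNonneg_three_of_core_twoLevelPlus`** — Kahn's Conjecture 5 (`MasterFamilyNonneg 3`) follows from `SahiTwoLevelPlus` (`T⁺ ≥ 0`) at ONE ESSENTIAL
  COORDINATE of every CORE triple (a coordinate essential to all three members; no canalyzing and no private essential coordinate).
* `masterFamilyNonneg_three_of_core_noIndepTops` — the core minus bnk-2's independent tops (`SahiTwoLevelIndep.twoLevelPlus_nonneg_of_determinedBy_pair`).
* **`masterFamilyNonneg_three_of_residualCore`** — THE RESIDUAL CORE: Kahn's Conjecture 5 follows from `C_3` on core triples whose EVERY essential coordinate `e` has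
  (i) negative third central moment of the three `1`-sections (else `…SahiTwoLevelKappa`) and (ii) no two `1`-sections determined by complementary coordinate sets
  (else independent tops).  Everything else on a cube is inherited (class T p306664, implied/required/private coordinates p307398, these two bnk-2 criteria).
HONEST FRAMING: reductions; `C_3` on the residual core remains OPEN (census: clean at `k = 5`, ttrl mtp2 T3.md §3/§5). [this work]
-/

noncomputable section

open scoped Classical

namespace Summit.CriticalPhenomena.PercolationContinuityZ3.Theorems

namespace SahiClassTCube

open Finset Function
open Literature.Combinatorics.Sahi2008
open Literature.Probability.LatticeModels (prodBernoulli)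
open Literature.Probability.Percolation (DeterminedBy)
open Literature.Probability.Percolation.DecisionTree (ind ind_of_mem ind_of_not_mem ind_nonneg)

variable {κ : Type} [Fintype κ]

/-! ### `SahiTwoLevelPlus` at ONE essential coordinate of every CORE triple suffices -/

/-- From bnk-2's TOP law at the section pair of `e` plus `C_3` of the two section triples: both mixed Bernstein coefficients at `e` are `≥ 0`
(`mixC2 = T⁺ + E_3(U¹)`, `mixC1 = T⁺ + ∏δ + E_3(U⁰)`). [this work] -/
theorem mixC_nonneg_of_twoLevelPlus (p : κ → unitInterval) (U : Fin 3 → Set (Set κ)) (hU : ∀ j, IsUpperSet (U j)) (e : κ)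
    (hplus : 0 ≤ twoLevelForm (fun X => (prodBernoulli p).real X) (fun i => secAt e true (U i)) (fun i => secAt e false (U i))
      - ∏ i : Fin 3, ((prodBernoulli p).real (secAt e true (U i)) - (prodBernoulli p).real (secAt e false (U i))))
    (h0 : 0 ≤ sahiE (bernoulliWeight p) 3 (fun i => ind (secAt e false (U i))))
    (h1 : 0 ≤ sahiE (bernoulliWeight p) 3 (fun i => ind (secAt e true (U i)))) :
    0 ≤ SahiCombMix.mixC1 (bernoulliWeight p) (fun i => secAt e false (U i)) (fun i => secAt e true (U i)) ∧
      0 ≤ SahiCombMix.mixC2 (bernoulliWeight p) (fun i => secAt e false (U i)) (fun i => secAt e true (U i)) := by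
  rw [mixC1_eq_twoLevelForm_add, mixC2_eq_twoLevelPlus_add]
  simp only [← ex_bernoulliWeight_ind] at hplus
  have hprod : 0 ≤ ∏ i : Fin 3, (ex (bernoulliWeight p) (ind (secAt e true (U i))) - ex (bernoulliWeight p) (ind (secAt e false (U i)))) :=
    Finset.prod_nonneg fun i _ => Pointwise.ex_secAt_true_sub_false_nonneg p e (hU i)
  constructor <;> linarith

/-- **KAHN'S CONJECTURE 5 FROM bnk-2's TOP LAW AT ONE ESSENTIAL COORDINATE OF EVERY CORE TRIPLE.**  If every CORE triple of increasing events (a coordinate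
essential to all three members; no canalyzing and no private essential coordinate) has, at every `p`, an ESSENTIAL coordinate `e` whose section pair satisfies
`T⁺(U^{e←1}, U^{e←0}) = twoLevelForm − ∏δ ≥ 0` (`SahiTwoLevelPlus` at that one pair), then `MasterFamilyNonneg 3` (⟺ `KahnConjecture`).  So `SahiTwoLevelPlus` is
needed ONLY at one essential coordinate of core triples (engine `sahiE_three_nonneg_of_core_step`: `C_3` of the two section triples comes from the induction). [this work] -/
theorem masterFamilyNonneg_three_of_core_twoLevelPlus
    (hplus : ∀ (κ : Type) [Fintype κ] (p : κ → unitInterval) (U : Fin 3 → Set (Set κ)), (∀ j, IsUpperSet (U j)) →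
      (∃ x, x ∈ esupp (U 0) ∧ x ∈ esupp (U 1) ∧ x ∈ esupp (U 2)) →
      (∀ j x, x ∈ esupp (U j) → ¬ ({ω : Set κ | x ∈ ω} ⊆ U j) ∧ ¬ (U j ⊆ {ω : Set κ | x ∈ ω})) →
      (∀ j x, x ∈ esupp (U j) → ∃ j', j' ≠ j ∧ x ∈ esupp (U j')) →
      ∃ (e : κ) (j : Fin 3), e ∈ esupp (U j) ∧
        0 ≤ twoLevelForm (fun X => (prodBernoulli p).real X) (fun i => secAt e true (U i)) (fun i => secAt e false (U i))
          - ∏ i : Fin 3, ((prodBernoulli p).real (secAt e true (U i)) - (prodBernoulli p).real (secAt e false (U i)))) :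
    MasterFamilyNonneg 3 := by
  intro κ _ p U hU
  refine sahiE_three_nonneg_of_core_step p (fun V hV h1 h2 h3 ih => ?_) U hU
  obtain ⟨e, j, he, hTe⟩ := hplus κ p V hV h1 h2 h3
  have E0 := ih (fun i => secAt e false (V i)) (fun i => isUpperSet_secAt e false (hV i)) (sum_card_esupp_secAt_lt V hV he false)
  have E1 := ih (fun i => secAt e true (V i)) (fun i => isUpperSet_secAt e true (hV i)) (sum_card_esupp_secAt_lt V hV he true)
  obtain ⟨hC1, hC2⟩ := mixC_nonneg_of_twoLevelPlus p V hV e hTe E0 E1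
  rw [Pointwise.sahiE_three_bernstein_secAt e V hV p]
  have ht0 : 0 ≤ (p e : ℝ) := (p e).2.1
  have ht1 : 0 ≤ 1 - (p e : ℝ) := sub_nonneg.2 (p e).2.2
  have a0 := mul_nonneg (pow_nonneg ht1 3) E0
  have a1 := mul_nonneg (mul_nonneg ht0 (pow_nonneg ht1 2)) hC1
  have a2 := mul_nonneg (mul_nonneg (pow_nonneg ht0 2) ht1) hC2
  have a3 := mul_nonneg (pow_nonneg ht0 3) E1
  linarith

/-- **The core shrinks by bnk-2's independent tops.**  Kahn's Conjecture 5 follows from `C_3` on those CORE triples which have NO essential coordinate `e` at which two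
of the three `1`-sections are determined by complementary sets of coordinates (at such a coordinate `SahiTwoLevelIndep.twoLevelPlus_nonneg_of_determinedBy_pair` gives
`T⁺ ≥ 0`).  E.g. the five-coin families of SAHI-ROUTE §4.36 (sections `y`, `y′` at `e`) are outside the remaining core. [this work] -/
theorem masterFamilyNonneg_three_of_core_noIndepTops
    (hcore : ∀ (κ : Type) [Fintype κ] (p : κ → unitInterval) (U : Fin 3 → Set (Set κ)), (∀ j, IsUpperSet (U j)) →
      (∃ x, x ∈ esupp (U 0) ∧ x ∈ esupp (U 1) ∧ x ∈ esupp (U 2)) →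
      (∀ j x, x ∈ esupp (U j) → ¬ ({ω : Set κ | x ∈ ω} ⊆ U j) ∧ ¬ (U j ⊆ {ω : Set κ | x ∈ ω})) →
      (∀ j x, x ∈ esupp (U j) → ∃ j', j' ≠ j ∧ x ∈ esupp (U j')) →
      (∀ (e : κ) (j : Fin 3), e ∈ esupp (U j) → ∀ (T : Finset κ) (i i' : Fin 3), i ≠ i' →
        DeterminedBy (secAt e true (U i)) (↑T : Set κ)ᶜ → ¬ DeterminedBy (secAt e true (U i')) (↑T : Set κ)) →
      0 ≤ sahiE (bernoulliWeight p) 3 (fun j => ind (U j))) :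
    MasterFamilyNonneg 3 := by
  intro κ _ p U hU
  refine sahiE_three_nonneg_of_core_step p (fun V hV h1 h2 h3 ih => ?_) U hU
  by_cases hind : ∃ (e : κ) (j : Fin 3), e ∈ esupp (V j) ∧ ∃ (T : Finset κ) (i i' : Fin 3), i ≠ i' ∧
      DeterminedBy (secAt e true (V i)) (↑T : Set κ)ᶜ ∧ DeterminedBy (secAt e true (V i')) (↑T : Set κ)
  · obtain ⟨e, j, he, T, i, i', hii', hi, hi'⟩ := hind
    have hTe := SahiTwoLevelIndep.twoLevelPlus_nonneg_of_determinedBy_pair p T (fun k => secAt e true (V k)) (fun k => secAt e false (V k))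
      (fun k => isUpperSet_secAt e true (hV k)) (fun k => isUpperSet_secAt e false (hV k))
      (fun k => RigidityAll.secAt_false_subset_secAt_true e (hV k)) hii' hi hi'
    have E0 := ih (fun k => secAt e false (V k)) (fun k => isUpperSet_secAt e false (hV k)) (sum_card_esupp_secAt_lt V hV he false)
    have E1 := ih (fun k => secAt e true (V k)) (fun k => isUpperSet_secAt e true (hV k)) (sum_card_esupp_secAt_lt V hV he true)
    obtain ⟨hC1, hC2⟩ := mixC_nonneg_of_twoLevelPlus p V hV e hTe E0 E1
    rw [Pointwise.sahiE_three_bernstein_secAt e V hV p]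
    have ht0 : 0 ≤ (p e : ℝ) := (p e).2.1
    have ht1 : 0 ≤ 1 - (p e : ℝ) := sub_nonneg.2 (p e).2.2
    have a0 := mul_nonneg (pow_nonneg ht1 3) E0
    have a1 := mul_nonneg (mul_nonneg ht0 (pow_nonneg ht1 2)) hC1
    have a2 := mul_nonneg (mul_nonneg (pow_nonneg ht0 2) ht1) hC2
    have a3 := mul_nonneg (pow_nonneg ht0 3) E1
    linarith
  · push Not at hind
    exact hcore κ p V hV h1 h2 h3 (fun e j he T i i' hii' hi => hind e j he T i i' hii' hi)


/-- **THE RESIDUAL CORE (all one-coordinate criteria in the tree).**  Kahn's Conjecture 5 follows from `C_3` on those CORE triples `U` for which EVERY essential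
coordinate `e` is "bad for every known reason": the third central moment of the three `1`-sections is NEGATIVE (else bnk-2's
`twoLevelPlus_nonneg_of_thirdCentralMoment_nonneg` gives `T⁺ ≥ 0`) AND no two of the three `1`-sections are determined by complementary coordinate sets (else
bnk-2's independent tops give `T⁺ ≥ 0`); in either good case the engine closes with `C_3` of the two section triples. [this work] -/
theorem masterFamilyNonneg_three_of_residualCore
    (hres : ∀ (κ : Type) [Fintype κ] (p : κ → unitInterval) (U : Fin 3 → Set (Set κ)), (∀ j, IsUpperSet (U j)) →
      (∃ x, x ∈ esupp (U 0) ∧ x ∈ esupp (U 1) ∧ x ∈ esupp (U 2)) →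
      (∀ j x, x ∈ esupp (U j) → ¬ ({ω : Set κ | x ∈ ω} ⊆ U j) ∧ ¬ (U j ⊆ {ω : Set κ | x ∈ ω})) →
      (∀ j x, x ∈ esupp (U j) → ∃ j', j' ≠ j ∧ x ∈ esupp (U j')) →
      (∀ (e : κ) (j : Fin 3), e ∈ esupp (U j) →
        thirdCentralMoment (fun X => (prodBernoulli p).real X) (fun i => secAt e true (U i)) < 0 ∧
        ∀ (T : Finset κ) (i i' : Fin 3), i ≠ i' →
          DeterminedBy (secAt e true (U i)) (↑T : Set κ)ᶜ → ¬ DeterminedBy (secAt e true (U i')) (↑T : Set κ)) →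
      0 ≤ sahiE (bernoulliWeight p) 3 (fun j => ind (U j))) :
    MasterFamilyNonneg 3 := by
  intro κ _ p U hU
  refine sahiE_three_nonneg_of_core_step p (fun V hV h1 h2 h3 ih => ?_) U hU
  -- a good essential coordinate (in either sense) closes the step
  have close : ∀ (e : κ) (j : Fin 3), e ∈ esupp (V j) →
      0 ≤ twoLevelForm (fun X => (prodBernoulli p).real X) (fun i => secAt e true (V i)) (fun i => secAt e false (V i))
        - ∏ i : Fin 3, ((prodBernoulli p).real (secAt e true (V i)) - (prodBernoulli p).real (secAt e false (V i))) →
      0 ≤ sahiE (bernoulliWeight p) 3 (fun j => ind (V j)) := by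
    intro e j he hTe
    have E0 := ih (fun k => secAt e false (V k)) (fun k => isUpperSet_secAt e false (hV k)) (sum_card_esupp_secAt_lt V hV he false)
    have E1 := ih (fun k => secAt e true (V k)) (fun k => isUpperSet_secAt e true (hV k)) (sum_card_esupp_secAt_lt V hV he true)
    obtain ⟨hC1, hC2⟩ := mixC_nonneg_of_twoLevelPlus p V hV e hTe E0 E1
    rw [Pointwise.sahiE_three_bernstein_secAt e V hV p]
    have ht0 : 0 ≤ (p e : ℝ) := (p e).2.1
    have ht1 : 0 ≤ 1 - (p e : ℝ) := sub_nonneg.2 (p e).2.2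
    have a0 := mul_nonneg (pow_nonneg ht1 3) E0
    have a1 := mul_nonneg (mul_nonneg ht0 (pow_nonneg ht1 2)) hC1
    have a2 := mul_nonneg (mul_nonneg (pow_nonneg ht0 2) ht1) hC2
    have a3 := mul_nonneg (pow_nonneg ht0 3) E1
    linarith
  by_cases hk : ∃ (e : κ) (j : Fin 3), e ∈ esupp (V j) ∧ 0 ≤ thirdCentralMoment (fun X => (prodBernoulli p).real X) (fun i => secAt e true (V i))
  · obtain ⟨e, j, he, hκ⟩ := hk
    exact close e j he (twoLevelPlus_nonneg_of_thirdCentralMoment_nonneg p (fun k => secAt e true (V k)) (fun k => secAt e false (V k))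
      (fun k => isUpperSet_secAt e true (hV k)) (fun k => isUpperSet_secAt e false (hV k))
      (fun k => RigidityAll.secAt_false_subset_secAt_true e (hV k)) hκ)
  by_cases hind : ∃ (e : κ) (j : Fin 3), e ∈ esupp (V j) ∧ ∃ (T : Finset κ) (i i' : Fin 3), i ≠ i' ∧
      DeterminedBy (secAt e true (V i)) (↑T : Set κ)ᶜ ∧ DeterminedBy (secAt e true (V i')) (↑T : Set κ)
  · obtain ⟨e, j, he, T, i, i', hii', hi, hi'⟩ := hind
    exact close e j he (SahiTwoLevelIndep.twoLevelPlus_nonneg_of_determinedBy_pair p T (fun k => secAt e true (V k)) (fun k => secAt e false (V k))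
      (fun k => isUpperSet_secAt e true (hV k)) (fun k => isUpperSet_secAt e false (hV k))
      (fun k => RigidityAll.secAt_false_subset_secAt_true e (hV k)) hii' hi hi')
  push Not at hk hind
  exact hres κ p V hV h1 h2 h3 (fun e j he => ⟨hk e j he, fun T i i' hii' hi => hind e j he T i i' hii' hi⟩)


/-! ### Appendix (same generation): the residual-core reduction as EQUIVALENCES, also in `KahnConjecture` form -/

/-- **Kahn's Conjecture 5 ⟺ `C_3` on the RESIDUAL CORE** (the converse direction is the trivial restriction). [this work] -/
theorem masterFamilyNonneg_three_iff_residualCore :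
    MasterFamilyNonneg 3 ↔
      ∀ (κ : Type) [Fintype κ] (p : κ → unitInterval) (U : Fin 3 → Set (Set κ)), (∀ j, IsUpperSet (U j)) →
        (∃ x, x ∈ esupp (U 0) ∧ x ∈ esupp (U 1) ∧ x ∈ esupp (U 2)) →
        (∀ j x, x ∈ esupp (U j) → ¬ ({ω : Set κ | x ∈ ω} ⊆ U j) ∧ ¬ (U j ⊆ {ω : Set κ | x ∈ ω})) →
        (∀ j x, x ∈ esupp (U j) → ∃ j', j' ≠ j ∧ x ∈ esupp (U j')) →
        (∀ (e : κ) (j : Fin 3), e ∈ esupp (U j) →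
          thirdCentralMoment (fun X => (prodBernoulli p).real X) (fun i => secAt e true (U i)) < 0 ∧
          ∀ (T : Finset κ) (i i' : Fin 3), i ≠ i' →
            DeterminedBy (secAt e true (U i)) (↑T : Set κ)ᶜ → ¬ DeterminedBy (secAt e true (U i')) (↑T : Set κ)) →
        0 ≤ sahiE (bernoulliWeight p) 3 (fun j => ind (U j)) :=
  ⟨fun h κ _ p U hU _ _ _ _ => h κ p U hU, masterFamilyNonneg_three_of_residualCore⟩

/-- **`KahnConjecture` ⟺ Kahn's inequality on the residual core of cubes** (via `masterFamilyNonneg_three_iff_kahnConjecture`). [this work] -/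
theorem kahnConjecture_iff_residualCore :
    KahnConjecture ↔
      ∀ (κ : Type) [Fintype κ] (p : κ → unitInterval) (U : Fin 3 → Set (Set κ)), (∀ j, IsUpperSet (U j)) →
        (∃ x, x ∈ esupp (U 0) ∧ x ∈ esupp (U 1) ∧ x ∈ esupp (U 2)) →
        (∀ j x, x ∈ esupp (U j) → ¬ ({ω : Set κ | x ∈ ω} ⊆ U j) ∧ ¬ (U j ⊆ {ω : Set κ | x ∈ ω})) →
        (∀ j x, x ∈ esupp (U j) → ∃ j', j' ≠ j ∧ x ∈ esupp (U j')) →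
        (∀ (e : κ) (j : Fin 3), e ∈ esupp (U j) →
          thirdCentralMoment (fun X => (prodBernoulli p).real X) (fun i => secAt e true (U i)) < 0 ∧
          ∀ (T : Finset κ) (i i' : Fin 3), i ≠ i' →
            DeterminedBy (secAt e true (U i)) (↑T : Set κ)ᶜ → ¬ DeterminedBy (secAt e true (U i')) (↑T : Set κ)) →
        0 ≤ sahiE (bernoulliWeight p) 3 (fun j => ind (U j)) := by
  rw [← masterFamilyNonneg_three_iff_kahnConjecture]
  exact masterFamilyNonneg_three_iff_residualCore

/-- **`KahnConjecture` ⟸ `SahiTwoLevelPlus` at one essential coordinate of every core triple** (Kahn form of `masterFamilyNonneg_three_of_core_twoLevelPlus`). [this work] -/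
theorem kahnConjecture_of_core_twoLevelPlus
    (hplus : ∀ (κ : Type) [Fintype κ] (p : κ → unitInterval) (U : Fin 3 → Set (Set κ)), (∀ j, IsUpperSet (U j)) →
      (∃ x, x ∈ esupp (U 0) ∧ x ∈ esupp (U 1) ∧ x ∈ esupp (U 2)) →
      (∀ j x, x ∈ esupp (U j) → ¬ ({ω : Set κ | x ∈ ω} ⊆ U j) ∧ ¬ (U j ⊆ {ω : Set κ | x ∈ ω})) →
      (∀ j x, x ∈ esupp (U j) → ∃ j', j' ≠ j ∧ x ∈ esupp (U j')) →
      ∃ (e : κ) (j : Fin 3), e ∈ esupp (U j) ∧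
        0 ≤ twoLevelForm (fun X => (prodBernoulli p).real X) (fun i => secAt e true (U i)) (fun i => secAt e false (U i))
          - ∏ i : Fin 3, ((prodBernoulli p).real (secAt e true (U i)) - (prodBernoulli p).real (secAt e false (U i)))) :
    KahnConjecture :=
  masterFamilyNonneg_three_iff_kahnConjecture.1 (masterFamilyNonneg_three_of_core_twoLevelPlus hplus)

end SahiClassTCube

end Summit.CriticalPhenomena.PercolationContinuityZ3.Theorems
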